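import Summits.HodgeConjecture.HodgeConjecture.Theorems.TropicalWeilObstructionTropicalWeilVanishingLiftCharacters
import HarnessLib

/-!
# Route `TropicalWeilObstruction` (Kontsevich's tropical test — NEGATION SINK, exploration, no summit claim):
# the Weil functional of ONE SHEET of lifts — the character identity behind `W(Z_t) = 4^{d-1}·i^t·Σ_T D_T D_{Tᶜ}`

Negation-sink bookkeeping of the cell `pub-hodge-tropical` (seat tropical-2 gen 34; algebraic core of HOME `certificates/schoen3-t2/README.md`
§2(c), the closed formula by which the independent engine computes the Weil functional of the tropical Schoen cycle sheet by sheet, and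
companion of `…TropicalWeilVanishingLiftCharacters` (§2(a): summed over ALL lifts the functional vanishes)).

Setting (docstring level). A top cell of a tropical complex of degree-`d` divisors on the base of a ℤ/4 cover, lifted with sheet vector
`k : ι → ℤ/4` (`|ι| = d`), has complex frame determinant `η_k = Σ_T χ_k(T)·D_T`, `χ_k(T) = ∏_{j∈T} I^{k_j}`; inside ONE linear system the
lifts split into four SHEETS by the value of `Σ_j k_j` (up to a cell-dependent constant; Abel's theorem), and the Weil functional of sheet `c`
collects `Σ_{Σk = c} η_k²`. This file proves, for every finite non-empty chip set `ι`:

* `fiber_sum_shift` — shifting one chip's sheet maps the fibre `{Σ_j k_j = c}` onto `{Σ_j k_j = c + 1}`; `four_mul_fiber_card` — every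
  fibre has `4^{d-1}` elements (`4·#fibre = 4^d`);
* `sheet_char_sum_step`, `sheet_char_sum_eq_zero` — the sheet sum `Σ_{Σk=c} χ_k(T)χ_k(T')` picks up the factor
  `μ_{j₀} = I^{[j₀∈T]+[j₀∈T']}` under the shift at `j₀`, so it VANISHES as soon as two chips have different `μ` — i.e. unless
  `(T, T') ∈ {(∅,∅), (T, Tᶜ), (univ, univ)}`;
* `prod_I_pow_eq_I_pow_sum` — on the complementary pair, `χ_k(T)χ_k(Tᶜ) = ∏_j I^{k_j} = I^{Σ_j k_j} = I^c` on the fibre;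
* **`four_mul_sheet_sum_sq`** — for coefficients `D` with `D ∅ = D univ = 0` (e.g. supported on `|T| = n`, `0 < n < d`):
  `4 · Σ_{k : Σ_j k_j = c} (Σ_T χ_k(T) D_T)² = 4^d · I^c · Σ_T D_T·D_{Tᶜ}`.
  So a sheet can have `W ≠ 0` only through COMPLEMENTARY pairs `T ⊔ Tᶜ`, which for `|T| = n` forces `d = 2n` chips — the canonical
  `g^{n}_{2n}` of Schoen's construction (`g²₄` on genus 3, `g³₆` on genus 4) —, the four sheets carry `W ∝ i^c`, and their sum is `0`
  (consistent with `…LiftCharacters.sum_sq_over_all_lifts_eq_zero`). With `D_T = det_ℂ(d_T)det(B_T)` this is exactly the per-cell factor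
  `4⁵·i^c·S_σ` of the engine (`n = 3`), resp. `4³·i^c·S_σ` (`n = 2`).

HONEST STATUS. Finite character identities over `ℂ`, kernel-checked; the tropical meaning is docstring-level. Decides nothing about K1
(`TropicalWeilVanishing`, `n = 4`, OPEN), K1_∂, K2, the `n = 3` calibration (`PrymThree.TropicalSchoenCalibrationThree`, computed true by two
exact engines outside the kernel, `@[conjecture]` inside) or the Hodge conjecture. Mathlib + HarnessLib only; no definition, no named-fact
hypothesis, no sorry.
References: [Zharkov2020TropicalWeil] I. Zharkov, arXiv:2002.02347, §2 (pp. 2–4); C. Schoen, Compositio Math. 65 (1988), §1.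
-/

set_option linter.dupNamespace false

noncomputable section

open scoped BigOperators
open Finset

namespace Summit.HodgeConjecture.HodgeConjecture.Theorems.TropicalWeilVanishing

namespace LiftCharacters

variable {ι : Type*} [DecidableEq ι]

/-! ### Powers of `I` only see exponents mod 4 -/

/-- `I^n = I^{n mod 4}`. [folklore] -/
theorem I_pow_mod_four (n : ℕ) : Complex.I ^ n = Complex.I ^ (n % 4) := by
  conv_lhs => rw [← Nat.div_add_mod n 4]
  rw [pow_add, pow_mul, Complex.I_pow_four, one_pow, one_mul]

/-- The value of a sum in `ℤ/4` (as `Fin 4`) agrees mod 4 with the sum of the values. [folklore] -/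
theorem val_sum_mod_four (s : Finset ι) (k : ι → Fin 4) :
    (((∑ j ∈ s, k j : Fin 4)) : ℕ) % 4 = (∑ j ∈ s, ((k j : Fin 4) : ℕ)) % 4 := by
  induction s using Finset.induction_on with
  | empty => simp
  | insert a s ha ih =>
    rw [Finset.sum_insert ha, Finset.sum_insert ha, Fin.val_add, Nat.mod_mod, Nat.add_mod, ih, ← Nat.add_mod]

/-- **The complementary pair sees the sheet.** `∏_{j} I^{k_j} = I^{Σ_j k_j}` (the exponent read in `ℤ/4`): on the fibre `Σ_j k_j = c`
the character of a complementary pair `χ_k(T)χ_k(Tᶜ)` is the constant `I^c`. [folklore] -/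
theorem prod_I_pow_eq_I_pow_sum [Fintype ι] (k : ι → Fin 4) :
    (∏ j, Complex.I ^ ((k j : Fin 4) : ℕ)) = Complex.I ^ (((∑ j, k j : Fin 4)) : ℕ) := by
  rw [Finset.prod_pow_eq_pow_sum, I_pow_mod_four, ← val_sum_mod_four, ← I_pow_mod_four]

/-! ### Fibres of `k ↦ Σ_j k_j` and the shift of one chip -/

/-- **Shift of one chip between fibres.** For any `F`, summing `F` over the fibre `{Σ_j k_j = c + 1}` is summing `k ↦ F(k + δ_{j₀})`
over the fibre `{Σ_j k_j = c}` (written with indicators over all of `ι → ℤ/4`). [folklore] -/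
theorem fiber_sum_shift [Fintype ι] (F : (ι → Fin 4) → ℂ) (c : Fin 4) (j₀ : ι) :
    (∑ k : ι → Fin 4, if (∑ j, k j) = c + 1 then F k else 0) =
      ∑ k : ι → Fin 4, if (∑ j, k j) = c then F (k + Pi.single j₀ 1) else 0 := by
  rw [← Equiv.sum_comp (Equiv.addRight (Pi.single j₀ (1 : Fin 4)))
    (fun k => if (∑ j, k j) = c + 1 then F k else 0)]
  refine Finset.sum_congr rfl fun k _ => ?_
  have hsum : (∑ j, (k + Pi.single j₀ (1 : Fin 4) : ι → Fin 4) j) = (∑ j, k j) + 1 := by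
    simp only [Pi.add_apply, Finset.sum_add_distrib, Finset.sum_pi_single', Finset.mem_univ, if_true]
  simp only [Equiv.coe_addRight, hsum, add_left_inj]

/-- **Every sheet has `4^{d-1}` lifts**: `4 · #{k : Σ_j k_j = c} = 4^{|ι|}` (the shift of one chip is a bijection between consecutive
fibres, and the four fibres partition `(ℤ/4)^ι`). [folklore] -/
theorem four_mul_fiber_card [Fintype ι] [Nonempty ι] (c : Fin 4) :
    4 * (∑ k : ι → Fin 4, if (∑ j, k j) = c then (1 : ℂ) else 0) = 4 ^ Fintype.card ι := by
  obtain ⟨j₀⟩ := ‹Nonempty ι›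
  -- consecutive fibres are equinumerous
  have step : ∀ c' : Fin 4, (∑ k : ι → Fin 4, if (∑ j, k j) = c' + 1 then (1 : ℂ) else 0) =
      ∑ k : ι → Fin 4, if (∑ j, k j) = c' then (1 : ℂ) else 0 := fun c' =>
    fiber_sum_shift (fun _ => (1 : ℂ)) c' j₀
  -- hence all fibres have the size of the fibre over `c`
  have all : ∀ c' : Fin 4, (∑ k : ι → Fin 4, if (∑ j, k j) = c' then (1 : ℂ) else 0) =
      ∑ k : ι → Fin 4, if (∑ j, k j) = c then (1 : ℂ) else 0 := by
    have h1 := step c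
    have h2 := step (c + 1)
    have h3 := step (c + 1 + 1)
    intro c'
    have hc' : c' = c ∨ c' = c + 1 ∨ c' = c + 1 + 1 ∨ c' = c + 1 + 1 + 1 := by
      fin_cases c <;> fin_cases c' <;> decide
    rcases hc' with h | h | h | h <;> subst h
    · rfl
    · rw [h1]
    · rw [h2, h1]
    · rw [h3, h2, h1]
  -- the four fibres partition the cube
  have total : (∑ c' : Fin 4, ∑ k : ι → Fin 4, if (∑ j, k j) = c' then (1 : ℂ) else 0) = 4 ^ Fintype.card ι := by
    rw [Finset.sum_comm]
    have : ∀ k : ι → Fin 4, (∑ c' : Fin 4, if (∑ j, k j) = c' then (1 : ℂ) else 0) = 1 := fun k => by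
      rw [Finset.sum_ite_eq]; simp
    simp_rw [this]
    simp only [Finset.sum_const, Finset.card_univ, Fintype.card_fun, Fintype.card_fin, nsmul_eq_mul, mul_one]
    push_cast
    ring
  rw [← total]
  simp_rw [all]
  simp only [Finset.sum_const, Finset.card_univ, Fintype.card_fin, nsmul_eq_mul]
  push_cast
  ring

/-! ### Sheet sums of products of two characters -/

/-- **Shift rule for sheet sums.** With `μ_{j₀} = I^{[j₀∈T]}·I^{[j₀∈T']}`:
`Σ_{Σk = c+1} χ_k(T)χ_k(T') = μ_{j₀} · Σ_{Σk = c} χ_k(T)χ_k(T')`. [folklore] -/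
theorem sheet_char_sum_step [Fintype ι] (T T' : Finset ι) (c : Fin 4) (j₀ : ι) :
    (∑ k : ι → Fin 4, if (∑ j, k j) = c + 1 then
        (∏ j ∈ T, Complex.I ^ ((k j : Fin 4) : ℕ)) * (∏ j ∈ T', Complex.I ^ ((k j : Fin 4) : ℕ)) else 0) =
      ((if j₀ ∈ T then Complex.I else 1) * (if j₀ ∈ T' then Complex.I else 1)) *
        ∑ k : ι → Fin 4, if (∑ j, k j) = c then
          (∏ j ∈ T, Complex.I ^ ((k j : Fin 4) : ℕ)) * (∏ j ∈ T', Complex.I ^ ((k j : Fin 4) : ℕ)) else 0 := by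
  rw [fiber_sum_shift, Finset.mul_sum]
  refine Finset.sum_congr rfl fun k _ => ?_
  by_cases h : (∑ j, k j) = c
  · rw [if_pos h, if_pos h, prod_I_pow_add_single k T j₀, prod_I_pow_add_single k T' j₀]; ring
  · rw [if_neg h, if_neg h, mul_zero]

/-- **Sheet orthogonality.** If two chips `j₀, j₁` have different shift factors `μ` for the pair `(T, T')` — which happens exactly unless
`(T, T')` is `(∅, ∅)`, a complementary pair `(T, Tᶜ)`, or `(univ, univ)` — then every sheet sum `Σ_{Σk = c} χ_k(T)χ_k(T')` vanishes.
[folklore] -/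
theorem sheet_char_sum_eq_zero [Fintype ι] (T T' : Finset ι) (j₀ j₁ : ι)
    (hμ : (if j₀ ∈ T then Complex.I else 1) * (if j₀ ∈ T' then Complex.I else 1) ≠
      (if j₁ ∈ T then Complex.I else 1) * (if j₁ ∈ T' then Complex.I else 1)) (c : Fin 4) :
    (∑ k : ι → Fin 4, if (∑ j, k j) = c then
        (∏ j ∈ T, Complex.I ^ ((k j : Fin 4) : ℕ)) * (∏ j ∈ T', Complex.I ^ ((k j : Fin 4) : ℕ)) else 0) = 0 := by
  have h0 := sheet_char_sum_step T T' c j₀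
  have h1 := sheet_char_sum_step T T' c j₁
  rw [h0] at h1
  -- (μ₀ - μ₁) · S = 0
  have h2 := sub_eq_zero.2 h1
  rw [← sub_mul] at h2
  rcases mul_eq_zero.1 h2 with h | h
  · exact absurd (sub_eq_zero.1 h) hμ
  · exact h

/-- For a pair `(T, T')` which is neither `(∅, ∅)`, nor complementary, nor `(univ, univ)`, two chips with different shift factors exist.
[folklore] -/
theorem exists_shift_factors_ne [Fintype ι] (T T' : Finset ι) (hc : T' ≠ Tᶜ) (h0 : ¬(T = ∅ ∧ T' = ∅))
    (h1 : ¬(T = univ ∧ T' = univ)) :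
    ∃ j₀ j₁ : ι, (if j₀ ∈ T then Complex.I else 1) * (if j₀ ∈ T' then Complex.I else 1) ≠
      (if j₁ ∈ T then Complex.I else 1) * (if j₁ ∈ T' then Complex.I else 1) := by
  have hI1 : (Complex.I : ℂ) ≠ 1 := fun h => by simpa using congrArg Complex.im h
  have hII : Complex.I * Complex.I ≠ (1 : ℂ) := by rw [Complex.I_mul_I]; norm_num
  have hIII : Complex.I * Complex.I ≠ Complex.I := by
    rw [Complex.I_mul_I]; intro h; simpa using congrArg Complex.re h
  -- a chip on which `T` and `T'` agree (exists since `T' ≠ Tᶜ`)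
  have hag : ∃ j, (j ∈ T ↔ j ∈ T') := by
    by_contra hne
    apply hc
    ext j
    rw [Finset.mem_compl]
    have hj : ¬(j ∈ T ↔ j ∈ T') := fun h => hne ⟨j, h⟩
    tauto
  obtain ⟨j, hj⟩ := hag
  by_cases hjT : j ∈ T
  · have hjT' : j ∈ T' := hj.1 hjT
    -- some chip is not in both (else `T = T' = univ`)
    have hex : ∃ j', ¬(j' ∈ T ∧ j' ∈ T') := by
      by_contra hall
      have hx : ∀ x, x ∈ T ∧ x ∈ T' := fun x => by
        by_contra h
        exact hall ⟨x, h⟩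
      exact h1 ⟨Finset.eq_univ_of_forall fun x => (hx x).1, Finset.eq_univ_of_forall fun x => (hx x).2⟩
    obtain ⟨j', hj'⟩ := hex
    refine ⟨j, j', ?_⟩
    rw [if_pos hjT, if_pos hjT']
    by_cases a : j' ∈ T
    · have b : j' ∉ T' := fun b => hj' ⟨a, b⟩
      rw [if_pos a, if_neg b, mul_one]; exact hIII
    · by_cases b : j' ∈ T'
      · rw [if_neg a, if_pos b, one_mul]; exact hIII
      · rw [if_neg a, if_neg b, mul_one]; exact hII
  · have hjT' : j ∉ T' := fun h => hjT (hj.2 h)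
    -- some chip is in `T ∪ T'` (else both empty)
    have hex : ∃ j', j' ∈ T ∨ j' ∈ T' := by
      by_contra hall
      have hx : ∀ x, ¬(x ∈ T ∨ x ∈ T') := fun x h => hall ⟨x, h⟩
      exact h0 ⟨Finset.eq_empty_of_forall_notMem fun x hx' => hx x (Or.inl hx'),
        Finset.eq_empty_of_forall_notMem fun x hx' => hx x (Or.inr hx')⟩
    obtain ⟨j', hj'⟩ := hex
    refine ⟨j', j, ?_⟩
    rw [if_neg hjT, if_neg hjT', mul_one]
    by_cases a : j' ∈ T
    · by_cases b : j' ∈ T'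
      · rw [if_pos a, if_pos b]; exact hII
      · rw [if_pos a, if_neg b, mul_one]; exact hI1
    · have b : j' ∈ T' := hj'.resolve_left a
      rw [if_neg a, if_pos b, one_mul]; exact hI1

/-! ### The Weil functional of one sheet -/

/-- **The Weil functional of ONE sheet of lifts.** For coefficients `D : Finset ι → ℂ` with `D ∅ = 0` and `D univ = 0` (e.g. the
Cauchy–Binet coefficients `D_T = det_ℂ(d_T)·det(B_T)`, supported on `|T| = n` with `0 < n < d = |ι|`) and every sheet `c ∈ ℤ/4`:
`4 · Σ_{k : Σ_j k_j = c} (Σ_T χ_k(T)·D_T)² = 4^{|ι|} · I^c · Σ_T D_T·D_{Tᶜ}`.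
Only complementary pairs survive (so `W ≠ 0` on a sheet needs `d = 2n` chips: the canonical `g^{n}_{2n}`), the four sheets carry
`W ∝ I^c`, and their sum vanishes. This is the closed formula `W(sheet c) = 4^{d−1} i^c Σ_σ V_σ i^{−φ_σ} S_σ` of HOME
`certificates/schoen3-t2/README.md` §2(c) at the level of one cell. [cite: Zharkov2020TropicalWeil, §2 (pp. 2–4)] -/
theorem four_mul_sheet_sum_sq [Fintype ι] [Nonempty ι] (D : Finset ι → ℂ) (hD0 : D ∅ = 0) (hD1 : D univ = 0)
    (c : Fin 4) :
    4 * (∑ k : ι → Fin 4, if (∑ j, k j) = c then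
        (∑ T : Finset ι, (∏ j ∈ T, Complex.I ^ ((k j : Fin 4) : ℕ)) * D T) ^ 2 else 0) =
      4 ^ Fintype.card ι * Complex.I ^ ((c : Fin 4) : ℕ) * ∑ T : Finset ι, D T * D Tᶜ := by
  set chi : (ι → Fin 4) → Finset ι → ℂ := fun k U => ∏ j ∈ U, Complex.I ^ ((k j : Fin 4) : ℕ) with hchi
  set N : ℂ := ∑ k : ι → Fin 4, if (∑ j, k j) = c then (1 : ℂ) else 0 with hN
  have h4N : 4 * N = 4 ^ Fintype.card ι := four_mul_fiber_card (ι := ι) c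
  -- the inner sheet sum for a pair (T, T'), weighted by D T * D T'
  have pair : ∀ T T' : Finset ι, D T * D T' * (∑ k : ι → Fin 4, if (∑ j, k j) = c then chi k T * chi k T' else 0) =
      if T' = Tᶜ then D T * D Tᶜ * (Complex.I ^ ((c : Fin 4) : ℕ) * N) else 0 := by
    intro T T'
    by_cases hc : T' = Tᶜ
    · rw [if_pos hc, hc]
      congr 1
      rw [hN, Finset.mul_sum]
      refine Finset.sum_congr rfl fun k _ => ?_
      by_cases h : (∑ j, k j) = c
      · rw [if_pos h, if_pos h, mul_one]
        show (∏ j ∈ T, Complex.I ^ ((k j : Fin 4) : ℕ)) * (∏ j ∈ Tᶜ, Complex.I ^ ((k j : Fin 4) : ℕ)) = _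
        rw [Finset.prod_mul_prod_compl, prod_I_pow_eq_I_pow_sum, h]
      · rw [if_neg h, if_neg h, mul_zero]
    · rw [if_neg hc]
      by_cases h0 : T = ∅ ∧ T' = ∅
      · rw [h0.1, hD0]; ring
      by_cases h1 : T = univ ∧ T' = univ
      · rw [h1.1, hD1]; ring
      obtain ⟨j₀, j₁, hμ⟩ := exists_shift_factors_ne T T' hc h0 h1
      have hz := sheet_char_sum_eq_zero T T' j₀ j₁ hμ c
      rw [show (∑ k : ι → Fin 4, if (∑ j, k j) = c then chi k T * chi k T' else 0) = 0 from hz, mul_zero]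
  -- the sheet sum itself
  have key : (∑ k : ι → Fin 4, if (∑ j, k j) = c then
      (∑ T : Finset ι, chi k T * D T) ^ 2 else 0) =
      (∑ T : Finset ι, D T * D Tᶜ) * (Complex.I ^ ((c : Fin 4) : ℕ) * N) := by
    have expand : ∀ k : ι → Fin 4, (if (∑ j, k j) = c then (∑ T : Finset ι, chi k T * D T) ^ 2 else 0) =
        ∑ T : Finset ι, ∑ T' : Finset ι, D T * D T' *
          (if (∑ j, k j) = c then chi k T * chi k T' else 0) := by
      intro k
      by_cases h : (∑ j, k j) = c
      · simp only [if_pos h]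
        rw [sq, Finset.sum_mul_sum]
        refine Finset.sum_congr rfl fun T _ => Finset.sum_congr rfl fun T' _ => by ring
      · simp only [if_neg h, mul_zero, Finset.sum_const_zero]
    calc (∑ k : ι → Fin 4, if (∑ j, k j) = c then (∑ T : Finset ι, chi k T * D T) ^ 2 else 0)
        = ∑ k : ι → Fin 4, ∑ T : Finset ι, ∑ T' : Finset ι, D T * D T' *
            (if (∑ j, k j) = c then chi k T * chi k T' else 0) := Finset.sum_congr rfl fun k _ => expand k
      _ = ∑ T : Finset ι, ∑ T' : Finset ι, ∑ k : ι → Fin 4, D T * D T' *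
            (if (∑ j, k j) = c then chi k T * chi k T' else 0) := by
          rw [Finset.sum_comm]
          exact Finset.sum_congr rfl fun T _ => Finset.sum_comm
      _ = ∑ T : Finset ι, ∑ T' : Finset ι, D T * D T' *
            ∑ k : ι → Fin 4, (if (∑ j, k j) = c then chi k T * chi k T' else 0) := by
          refine Finset.sum_congr rfl fun T _ => Finset.sum_congr rfl fun T' _ => ?_
          rw [Finset.mul_sum]
      _ = ∑ T : Finset ι, ∑ T' : Finset ι,
            (if T' = Tᶜ then D T * D Tᶜ * (Complex.I ^ ((c : Fin 4) : ℕ) * N) else 0) := by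
          refine Finset.sum_congr rfl fun T _ => Finset.sum_congr rfl fun T' _ => pair T T'
      _ = ∑ T : Finset ι, D T * D Tᶜ * (Complex.I ^ ((c : Fin 4) : ℕ) * N) := by
          refine Finset.sum_congr rfl fun T _ => ?_
          rw [Finset.sum_ite_eq' Finset.univ (Tᶜ)]
          simp only [Finset.mem_univ, if_true]
      _ = (∑ T : Finset ι, D T * D Tᶜ) * (Complex.I ^ ((c : Fin 4) : ℕ) * N) := by
          rw [Finset.sum_mul]
  show 4 * (∑ k : ι → Fin 4, if (∑ j, k j) = c then (∑ T : Finset ι, chi k T * D T) ^ 2 else 0) = _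
  rw [key]
  linear_combination ((∑ T : Finset ι, D T * D Tᶜ) * Complex.I ^ ((c : Fin 4) : ℕ)) * h4N

end LiftCharacters

end Summit.HodgeConjecture.HodgeConjecture.Theorems.TropicalWeilVanishing

end
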